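import Summits.QuantumFields.YangMills.Theorems.BalabanUVNodesN15KingModelCombesThomasEffLapLipschitz
import Summits.QuantumFields.YangMills.Theorems.BalabanUVNodesN15KingModelCovariantBlockFieldCovariance
import HarnessLib

/-!
# BalabanUVNodes ∕ N15 — THE KING-MODEL RUNG (PART Ϧ-m): THE BLOCK-FIELD COVARIANCE `(Δ_eff(U))⁻¹ = a⁻¹ + Q(U)(−cΔ_U+m²)⁻¹Q(U)^*` — NE2's UNIT LAYER — IS `η`-UNIFORMLY LIPSCHITZ IN THE
# BACKGROUND ON BAŁABAN's SCALE: the fine covariance is Lipschitz in the `H¹` currency (PART Ϧ-h at `a = 0`, floor `m²`), the covariant block mean is Lipschitz (PART Ϧ-l), hence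
# `‖(Δ_eff(U))⁻¹ − (Δ_eff(V))⁻¹‖ ≤ 2Dε∕m² + 2√(d+1)s∕(m²·m) + 2(d+1)s²∕m⁴` (`s = √c·ε`); in King's scaling a function of `Lε = ε∕η` only
# (Track A, DAG node N15 = NE2; FAN-OUT v1.1 §N15 s3 «KING-MODEL RUNG … + what the curved case adds»; count-neutral)

HONEST FRAMING.  Count-neutral (cell `pub-ymgap`, seat `pub-ymgap-dag-n15-e` g50; `--supports stmt-QuantumFields-27247 --as helper` = K3ᴬ, KEY MAP v3).  King's one-level comparison model (Woodbury
form of PART Ϥ-k, `m² > 0`, `a > 0`), unitary link fields, any fibre, operator norms; constants in `1∕m²` (King's block-unit mass).  This is the `U`-DEPENDENCE of NE2's unit-layer object at ONE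
level; NOT its two-spacing `η`-rate (the background at two scales, g49's located caveat (t5⁵⁵)); NOT Bałaban's multi-level objects; NOT a node discharge (N15 of record untouched); nothing
continuum ∕ ℝ⁴ ∕ OS ∕ Clay.

THE RESULTS (`T` a tree contour system of depth `≤ D`; unitary `U, V` with `‖U_b − V_b‖ ≤ ε` on every bond; `c ≥ 0`, `m² > 0`):
* §1 `fullOpU_zero_eq_covLapF` (`A₀(U)` at `a = 0` is the fine operator), `re_quadForm_covLapF_ge_mass'` (`m²Σ‖v_x‖² ≤ Re⟨v,(−cΔ_U+m²)v⟩`), ★★★ **`l2_opNorm_covLapF_inv_sub_le`** (`‖M_U⁻¹ − M_V⁻¹‖ ≤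
  2√(d+1)s∕(m²√m²) + 2(d+1)s²∕m⁴`, `s = √c·ε` — the FINE covariance is `η`-uniformly Lipschitz on the scale `εη`; PART Ϛ∕Ͱ had the `ℓ²`-operator version with constant `O(cε)`).
* §2 ★ `l2_opNorm_sandwich_sub_sandwich_le` (`‖Q(U)XQ(U)^* − Q(V)YQ(V)^*‖ ≤ 2Dε·γ + Λ` for `‖X‖,‖Y‖ ≤ γ`, `‖X − Y‖ ≤ Λ`), ★★★★ **`l2_opNorm_effLapU_inv_sub_le`** (`a > 0`:
  `‖(Δ_eff(U))⁻¹ − (Δ_eff(V))⁻¹‖ ≤ 2Dε∕m² + 2√(d+1)s∕(m²√m²) + 2(d+1)s²∕m⁴`), ★★★★ **`l2_opNorm_effLapU_inv_sub_le_king`** (King's scaling, comb: `≤ 2(d+1)(Lε)∕m² + 2√(d+1)(Lε)∕(m²√m²) +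
  2(d+1)(Lε)²∕m⁴` — NE2's unit-layer covariance depends on the background `η`-UNIFORMLY on the scale `ε₁η`, every `L`, volume, fibre).
PRIOR TREE ART (by name): Ϧ-h (`l2_opNorm_fullOpU_inv_sub_le`), Ϧ-l (`l2_opNorm_covQ_sub_mul_kingQadjU_le`, `l2_opNorm_covQ_mul_kingQadjU_le`), Ϧ-a (`l2_opNorm_inv_le_of_reCoercive`), Ϥ-k
(`effLapU_inv_eq_noise_add_blockAvg`), Ϥ-d (`fullOpU`, `kingQadjU`), Ϳ-b (`re_quadForm_covLapF_eq_bondE`, `bondE_nonneg`), Mathlib (`Matrix.l2_opNorm_mul`).  Dedup (rg at filing): basename 0 files; needles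
`fullOpU_zero_eq_covLapF|l2_opNorm_covLapF_inv_sub_le|l2_opNorm_sandwich_sub_sandwich_le|l2_opNorm_effLapU_inv_sub_le` 0 tree files.  Locators: [King1986] (2.14) p.653, (4.44)–(4.45) p.675, (4.34)
p.674; [Balaban1985BackgroundPropagators] (3.23)–(3.25) p.394, (3.37) p.396, (3.48)–(3.50) pp.398–400 (shape).  0 `sorry`, 0 `def`.
-/

noncomputable section
open scoped BigOperators ComplexConjugate ComplexOrder InnerProductSpace Matrix.Norms.L2Operator
open Finset Matrix WithLp

namespace Summit.QuantumFields.YangMills.BalabanUVNodes.N15KingModelRung.CombesThomas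

open Literature.MathematicalPhysics.QuantumFieldTheory.Balaban1983to89.B5Prop11Plancherel (Tor fine unitVec)
open Summit.QuantumFields.YangMills.BalabanUVNodes.N15KingModelRung.Covariant (covLapF fib)
open Summit.QuantumFields.YangMills.BalabanUVNodes.N15KingModelRung.Curvature (bondE bondE_nonneg re_quadForm_covLapF_eq_bondE)
open Summit.QuantumFields.YangMills.BalabanUVNodes.N15KingModelRung.CovariantBlock
  (BlockTree kingComb kingComb_depth_le covQ kingQadjU fullOpU effLapU effLapU_inv_eq_noise_add_blockAvg)

variable {d : ℕ} {L : ℕ} [NeZero L] (T : BlockTree d L) (M : Fin (d + 1) → ℕ) [hM : ∀ μ, NeZero (M μ)]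
variable {𝕜 : Type*} [RCLike 𝕜] {n : Type*} [Fintype n] [DecidableEq n]

/-! ## §1 The fine covariance is `η`-uniformly Lipschitz (the `a = 0` case of PART Ϧ-h) -/

section Fine

/-- At `a = 0` the full operator is the fine operator: `A₀(U)|_{a=0} = −cΔ_U + m²`. [cite: King1986, (2.13) p.653] -/
theorem fullOpU_zero_eq_covLapF (c m2 : ℝ) (U : Tor (fine L M) × Fin (d + 1) → Matrix n n 𝕜) : fullOpU T M 0 c m2 U = covLapF (fine L M) c m2 U := by
  rw [fullOpU, zero_mul, RCLike.ofReal_zero, zero_smul, add_zero]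

/-- `m²Σ‖v_x‖² ≤ Re⟨v,(−cΔ_U+m²)v⟩` for unitary `U`, `c ≥ 0` (the covariant Dirichlet form is non-negative). [cite: Balaban1985BackgroundPropagators, (3.23) p.394] -/
theorem re_quadForm_covLapF_ge_mass' {c : ℝ} (hc : 0 ≤ c) (m2 : ℝ) {U : Tor (fine L M) × Fin (d + 1) → Matrix n n 𝕜} (hU : ∀ bd, U bd ∈ Matrix.unitaryGroup n 𝕜)
    (v : Tor (fine L M) × n → 𝕜) : m2 * ∑ x, ‖fib (fine L M) v x‖ ^ 2 ≤ RCLike.re (star v ⬝ᵥ (fullOpU T M 0 c m2 U *ᵥ v)) := by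
  rw [fullOpU_zero_eq_covLapF, re_quadForm_covLapF_eq_bondE (fine L M) c m2 hU v]
  have : 0 ≤ c * ∑ x, ∑ μ, bondE (fine L M) U v x μ := mul_nonneg hc (Finset.sum_nonneg fun x _ => Finset.sum_nonneg fun μ _ => bondE_nonneg (fine L M) U v x μ)
  linarith

/-- ★★★ **THE FINE COVARIANCE IS `η`-UNIFORMLY LIPSCHITZ IN THE FIELD** (`H¹` currency): unitary `U, V` with `‖U_b − V_b‖ ≤ ε` bondwise, `c ≥ 0`, `m² > 0`, `s = √c·ε`:
`‖(−cΔ_U+m²)⁻¹ − (−cΔ_V+m²)⁻¹‖ ≤ 2√(d+1)·s∕(m²√m²) + 2(d+1)s²∕m⁴`. [cite: Balaban1985BackgroundPropagators, (3.23) p.394, (3.48)–(3.50) pp.398–400 (shape); King1986, (4.4) p.670] -/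
theorem l2_opNorm_covLapF_inv_sub_le {c m2 : ℝ} (hc : 0 ≤ c) (hm : 0 < m2) {U V : Tor (fine L M) × Fin (d + 1) → Matrix n n 𝕜} (hU : ∀ bd, U bd ∈ Matrix.unitaryGroup n 𝕜)
    (hV : ∀ bd, V bd ∈ Matrix.unitaryGroup n 𝕜) {ε : ℝ} (hε0 : 0 ≤ ε) (hε : ∀ bd, ‖U bd - V bd‖ ≤ ε) :
    ‖(covLapF (fine L M) c m2 U)⁻¹ - (covLapF (fine L M) c m2 V)⁻¹‖
      ≤ 2 * Real.sqrt ((d : ℝ) + 1) * (Real.sqrt c * ε) / (m2 * Real.sqrt m2) + 2 * ((d : ℝ) + 1) * (Real.sqrt c * ε) ^ 2 / m2 ^ 2 := by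
  -- any tree contour system will do (the block term is absent at `a = 0`); take the comb
  have h := l2_opNorm_fullOpU_inv_sub_le (kingComb d L) M le_rfl hc hm.le kingComb_depth_le hU hV hε0 hε hm
    (re_quadForm_covLapF_ge_mass' (kingComb d L) M hc m2 hU) (re_quadForm_covLapF_ge_mass' (kingComb d L) M hc m2 hV)
  rw [fullOpU_zero_eq_covLapF, fullOpU_zero_eq_covLapF] at h
  refine h.trans (le_of_eq ?_)
  rw [zero_mul, zero_mul, mul_zero, add_zero]

end Fine

/-! ## §2 The block-field covariance is `η`-uniformly Lipschitz -/

section BlockCov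

/-- ★ THE SANDWICH DIFFERENCE: `‖Q(U)XQ(U)^* − Q(V)YQ(V)^*‖ ≤ 2Dε·γ + Λ` whenever `‖X‖, ‖Y‖ ≤ γ`, `‖X − Y‖ ≤ Λ` (unitary `U, V` with `‖U_b − V_b‖ ≤ ε`, depth `≤ D`; three-term split, PART Ϧ-l's block-mean bounds).
[cite: King1986, (2.14) p.653] -/
theorem l2_opNorm_sandwich_sub_sandwich_le {D : ℕ} (hD : ∀ j, T.depth j ≤ D) {U V : Tor (fine L M) × Fin (d + 1) → Matrix n n 𝕜} (hU : ∀ bd, U bd ∈ Matrix.unitaryGroup n 𝕜)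
    (hV : ∀ bd, V bd ∈ Matrix.unitaryGroup n 𝕜) {ε : ℝ} (hε0 : 0 ≤ ε) (hε : ∀ bd, ‖U bd - V bd‖ ≤ ε)
    (X Y : Matrix (Tor (fine L M) × n) (Tor (fine L M) × n) 𝕜) {γ Λ : ℝ} (hX : ‖X‖ ≤ γ) (hY : ‖Y‖ ≤ γ) (hΛ : ‖X - Y‖ ≤ Λ) :
    ‖covQ T M U * X * kingQadjU T M U - covQ T M V * Y * kingQadjU T M V‖ ≤ 2 * ((D : ℝ) * ε) * γ + Λ := by
  have hsplit : covQ T M U * X * kingQadjU T M U - covQ T M V * Y * kingQadjU T M V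
      = (covQ T M U - covQ T M V) * X * kingQadjU T M U + covQ T M V * (X - Y) * kingQadjU T M U + covQ T M V * Y * (kingQadjU T M U - kingQadjU T M V) := by
    simp only [Matrix.sub_mul, Matrix.mul_sub]; abel
  have hq1 := l2_opNorm_covQ_sub_mul_kingQadjU_le T M hD hU hV hU hε0 hε
  have hq2 := l2_opNorm_covQ_mul_kingQadjU_le T M hU hV
  have hq3 : ‖covQ T M V‖ * ‖kingQadjU T M U - kingQadjU T M V‖ ≤ (D : ℝ) * ε := by
    have h : kingQadjU T M U - kingQadjU T M V = ((L : 𝕜) ^ (d + 1)) • (covQ T M U - covQ T M V)ᴴ := by rw [kingQadjU, kingQadjU, conjTranspose_sub, smul_sub]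
    have e : ‖covQ T M V‖ * ‖kingQadjU T M U - kingQadjU T M V‖ = ‖covQ T M U - covQ T M V‖ * ‖kingQadjU T M V‖ := by
      rw [h, kingQadjU, norm_smul, norm_smul, Matrix.l2_opNorm_conjTranspose, Matrix.l2_opNorm_conjTranspose]; ring
    rw [e]; exact l2_opNorm_covQ_sub_mul_kingQadjU_le T M hD hU hV hV hε0 hε
  have hγ : 0 ≤ γ := (norm_nonneg _).trans hX
  have t1 : ‖(covQ T M U - covQ T M V) * X * kingQadjU T M U‖ ≤ (D : ℝ) * ε * γ := by
    calc ‖(covQ T M U - covQ T M V) * X * kingQadjU T M U‖ ≤ ‖covQ T M U - covQ T M V‖ * ‖X‖ * ‖kingQadjU T M U‖ :=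
          (Matrix.l2_opNorm_mul _ _).trans (mul_le_mul_of_nonneg_right (Matrix.l2_opNorm_mul _ _) (norm_nonneg _))
      _ = (‖covQ T M U - covQ T M V‖ * ‖kingQadjU T M U‖) * ‖X‖ := by ring
      _ ≤ (D : ℝ) * ε * γ := mul_le_mul hq1 hX (norm_nonneg _) (by positivity)
  have t2 : ‖covQ T M V * (X - Y) * kingQadjU T M U‖ ≤ Λ := by
    calc ‖covQ T M V * (X - Y) * kingQadjU T M U‖ ≤ ‖covQ T M V‖ * ‖X - Y‖ * ‖kingQadjU T M U‖ :=
          (Matrix.l2_opNorm_mul _ _).trans (mul_le_mul_of_nonneg_right (Matrix.l2_opNorm_mul _ _) (norm_nonneg _))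
      _ = (‖covQ T M V‖ * ‖kingQadjU T M U‖) * ‖X - Y‖ := by ring
      _ ≤ 1 * Λ := mul_le_mul hq2 hΛ (norm_nonneg _) zero_le_one
      _ = Λ := one_mul Λ
  have t3 : ‖covQ T M V * Y * (kingQadjU T M U - kingQadjU T M V)‖ ≤ (D : ℝ) * ε * γ := by
    calc ‖covQ T M V * Y * (kingQadjU T M U - kingQadjU T M V)‖ ≤ ‖covQ T M V‖ * ‖Y‖ * ‖kingQadjU T M U - kingQadjU T M V‖ :=
          (Matrix.l2_opNorm_mul _ _).trans (mul_le_mul_of_nonneg_right (Matrix.l2_opNorm_mul _ _) (norm_nonneg _))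
      _ = (‖covQ T M V‖ * ‖kingQadjU T M U - kingQadjU T M V‖) * ‖Y‖ := by ring
      _ ≤ (D : ℝ) * ε * γ := mul_le_mul hq3 hY (norm_nonneg _) (by positivity)
  rw [hsplit]
  calc ‖(covQ T M U - covQ T M V) * X * kingQadjU T M U + covQ T M V * (X - Y) * kingQadjU T M U + covQ T M V * Y * (kingQadjU T M U - kingQadjU T M V)‖
      ≤ ‖(covQ T M U - covQ T M V) * X * kingQadjU T M U‖ + ‖covQ T M V * (X - Y) * kingQadjU T M U‖ + ‖covQ T M V * Y * (kingQadjU T M U - kingQadjU T M V)‖ :=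
        (norm_add_le _ _).trans (add_le_add (norm_add_le _ _) le_rfl)
    _ ≤ (D : ℝ) * ε * γ + Λ + (D : ℝ) * ε * γ := add_le_add (add_le_add t1 t2) t3
    _ = 2 * ((D : ℝ) * ε) * γ + Λ := by ring

/-- ★★★★ **THE BLOCK-FIELD COVARIANCE IS `η`-UNIFORMLY LIPSCHITZ IN THE BACKGROUND**: `a > 0`, `c ≥ 0`, `m² > 0`, contours of depth `≤ D`, unitary `U, V` with `‖U_b − V_b‖ ≤ ε` bondwise,
`s = √c·ε`:  `‖(Δ_eff(U))⁻¹ − (Δ_eff(V))⁻¹‖ ≤ 2Dε∕m² + 2√(d+1)·s∕(m²√m²) + 2(d+1)s²∕m⁴` (Woodbury at every `U`, PART Ϥ-k; the `a⁻¹·1` cancels).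
[cite: King1986, (2.14) p.653, (4.44)–(4.45) p.675; Balaban1985BackgroundPropagators, (3.25) p.394, (3.48)–(3.50) pp.398–400 (shape)] -/
theorem l2_opNorm_effLapU_inv_sub_le {D : ℕ} (hD : ∀ j, T.depth j ≤ D) {a c m2 : ℝ} (ha : 0 < a) (hc : 0 ≤ c) (hm : 0 < m2) {U V : Tor (fine L M) × Fin (d + 1) → Matrix n n 𝕜}
    (hU : ∀ bd, U bd ∈ Matrix.unitaryGroup n 𝕜) (hV : ∀ bd, V bd ∈ Matrix.unitaryGroup n 𝕜) {ε : ℝ} (hε0 : 0 ≤ ε) (hε : ∀ bd, ‖U bd - V bd‖ ≤ ε) :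
    ‖(effLapU T M a c m2 U)⁻¹ - (effLapU T M a c m2 V)⁻¹‖
      ≤ 2 * ((D : ℝ) * ε) * m2⁻¹ + (2 * Real.sqrt ((d : ℝ) + 1) * (Real.sqrt c * ε) / (m2 * Real.sqrt m2) + 2 * ((d : ℝ) + 1) * (Real.sqrt c * ε) ^ 2 / m2 ^ 2) := by
  rw [effLapU_inv_eq_noise_add_blockAvg T M ha hc hm hU, effLapU_inv_eq_noise_add_blockAvg T M ha hc hm hV, add_sub_add_left_eq_sub]
  have hGU : ‖(covLapF (fine L M) c m2 U)⁻¹‖ ≤ m2⁻¹ := by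
    have h := l2_opNorm_inv_le_of_reCoercive (fine L M) hm (re_quadForm_covLapF_ge_mass' T M hc m2 hU)
    rwa [fullOpU_zero_eq_covLapF] at h
  have hGV : ‖(covLapF (fine L M) c m2 V)⁻¹‖ ≤ m2⁻¹ := by
    have h := l2_opNorm_inv_le_of_reCoercive (fine L M) hm (re_quadForm_covLapF_ge_mass' T M hc m2 hV)
    rwa [fullOpU_zero_eq_covLapF] at h
  exact l2_opNorm_sandwich_sub_sandwich_le T M hD hU hV hε0 hε _ _ hGU hGV (l2_opNorm_covLapF_inv_sub_le M hc hm hU hV hε0 hε)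

/-- ★★★★ **KING's SCALING: NE2's UNIT-LAYER COVARIANCE DEPENDS ON THE BACKGROUND `η`-UNIFORMLY ON BAŁABAN's SCALE** — `c = L²`, comb contours, `a > 0`, `m² > 0`, unitary `U, V` with
`‖U_b − V_b‖ ≤ ε` bondwise:  `‖(Δ_eff(U))⁻¹ − (Δ_eff(V))⁻¹‖ ≤ 2(d+1)(Lε)∕m² + 2√(d+1)(Lε)∕(m²√m²) + 2(d+1)(Lε)²∕m⁴` — a function of `Lε = ε∕η` only, every `L`, volume, fibre.
[cite: King1986, (2.14) p.653, (4.34) p.674, (4.44)–(4.45) p.675; Balaban1985BackgroundPropagators, (3.37) p.396, (3.48)–(3.50) pp.398–400 (shape)] -/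
theorem l2_opNorm_effLapU_inv_sub_le_king {a m2 : ℝ} (ha : 0 < a) (hm : 0 < m2) {U V : Tor (fine L M) × Fin (d + 1) → Matrix n n 𝕜}
    (hU : ∀ bd, U bd ∈ Matrix.unitaryGroup n 𝕜) (hV : ∀ bd, V bd ∈ Matrix.unitaryGroup n 𝕜) {ε : ℝ} (hε0 : 0 ≤ ε) (hε : ∀ bd, ‖U bd - V bd‖ ≤ ε) :
    ‖(effLapU (kingComb d L) M a ((L : ℝ) ^ 2) m2 U)⁻¹ - (effLapU (kingComb d L) M a ((L : ℝ) ^ 2) m2 V)⁻¹‖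
      ≤ 2 * ((d : ℝ) + 1) * ((L : ℝ) * ε) * m2⁻¹ + (2 * Real.sqrt ((d : ℝ) + 1) * ((L : ℝ) * ε) / (m2 * Real.sqrt m2) + 2 * ((d : ℝ) + 1) * ((L : ℝ) * ε) ^ 2 / m2 ^ 2) := by
  have hL0 : (0 : ℝ) ≤ L := Nat.cast_nonneg L
  have hD : ((((d + 1) * (L - 1) : ℕ)) : ℝ) ≤ ((d : ℝ) + 1) * L := by
    have : (((L - 1 : ℕ)) : ℝ) ≤ L := by exact_mod_cast Nat.sub_le L 1
    push_cast; nlinarith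
  have h := l2_opNorm_effLapU_inv_sub_le (kingComb d L) M kingComb_depth_le ha (by positivity : (0 : ℝ) ≤ (L : ℝ) ^ 2) hm hU hV hε0 hε
  rw [Real.sqrt_sq hL0] at h
  refine h.trans (add_le_add ?_ le_rfl)
  have hk : 0 ≤ m2⁻¹ := inv_nonneg.mpr hm.le
  calc 2 * ((((d + 1) * (L - 1) : ℕ) : ℝ) * ε) * m2⁻¹ ≤ 2 * ((((d : ℝ) + 1) * L) * ε) * m2⁻¹ :=
        mul_le_mul_of_nonneg_right (mul_le_mul_of_nonneg_left (mul_le_mul_of_nonneg_right hD hε0) (by norm_num)) hk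
    _ = 2 * ((d : ℝ) + 1) * ((L : ℝ) * ε) * m2⁻¹ := by ring

end BlockCov

end Summit.QuantumFields.YangMills.BalabanUVNodes.N15KingModelRung.CombesThomas

end
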